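import Mathlib
import HarnessLib
import HarnessLib.Audit
import Summits.NavierStokesRegularity.Statement
import Literature.Analysis.FluidPDE.ClassicalSolution
import Literature.Analysis.FluidPDE.LerayHopf
import Literature.Analysis.FluidPDE.NSWave0
import Literature.Analysis.FluidPDE.VectorCalculus
import Literature.Analysis.FluidPDE.Vorticity
import Literature.Analysis.FluidPDE.SuitableWeak
import Literature.Analysis.FluidPDE.SelfSimilar
import Literature.Analysis.FluidPDE.LocalTypeI
import Summits.NavierStokesRegularity.NavierStokesRegularity.Theorems.TypeICertificateLadderNoBlowupToClay
import HarnessLib.Audit.Status.Attr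

/-!
Route: StretchingWellBinding

DORMANT since 2026-08-29T19:39:03Z (census g0: costume|duplicate of route-NavierStokesRegularity-HalfHolderEnergy; reader census-reader-50-g0) — unstaffed, not closed; items shared with open routes are served there. `ledger route dormant <id> --off` reactivates.

Route StretchingWellBinding — NavierStokesRegularity (Clay A), positive side; realises idea card
NavierStokesRegularity/NavierStokesRegularity/stretching-well-binding ("No binding, no blow-up";
absorbs the retired siblings
hardy-quarter-stretching-spectrum and leray-quanta-energy-modulus).

ORGANISING OBJECT (card). For a classical solution put α := ξ·Sξ = ⟨ξ,(∇u)ξ⟩ (ξ = ω/|ω|), the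
stretching rate, and
Λ(t) := sup over test fields ψ of (∫α₊|ψ|² − ν∫|∇ψ|²)/∫|ψ|² = sup spec(νΔ + α₊(·,t)) — the
ground-state energy of a
Schrödinger operator whose well is the positive stretching. Enstrophy Ω(t) = ∫|ω|² obeys dΩ/dt ≤
2Λ(t)Ω(t) (Kato + Rayleigh),
so blow-up at T forces ∫^T Λ = ∞, while Leray's lower bound Ω ≥ cν^{3/2}(T−t)^{-1/2} forces ∫_{t₀}^t
Λ ≥ ¼log(1/(T−t)) − C.

THESIS X ("it suffices to show X") = QuarterLaw ∧ NoLocalTypeI: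
 (i) EnstrophyQuarterLaw — every finite-energy classical solution from a rapidly decaying datum
which is maximal at T < ∞ has
     Ω(t) ≤ K (T−t)^{-1/2} on [0,T): enstrophy blows up at exactly Leray's rate, never faster.
Equivalently the binding history
     exceeds the quarter rate only integrably: ∫_{t₀}^t (Λ_eff(s) − 1/(4(T−s))) ds = O(1), Λ_eff :=
½ d/dt log Ω ≤ Λ
     ("Type II ⇔ the stretching well binds more than a quarter per unit log-time").
 (ii) NoLocalTypeISingularity — no suitable weak solution of NS has a Type-I singular point in the
rescaled-energy sense of
     Albritton–Barker (𝐈(Q') = sup_{Q''⊆Q'}(A+C+D+E) < ∞); under AB's forward theorem this is (L') =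
"no nontrivial mild bounded
     ancient solution with 𝐈 < ∞", implied by the KNSS Liouville conjecture (L).
Lean (elaborate, Sketch.lean rc 0):
 EnstrophyQuarterLaw := ∀ ν T, 0<ν → 0<T → ∀ u p, IsMaximalSmoothSolution ν 0 u p T → IsLerayHopfOn
T ν 0 (u 0) u →
   HasRapidSpatialDecay (u 0) → ∃ K, ∀ t ∈ Ico 0 T, ∫⁻ x, ‖curl (u t) x‖ₑ^2 ≤ ofReal (K / √(T−t))
 NoLocalTypeISingularity := ¬ ∃ r₀ z u p, Literature.Analysis.FluidPDE.IsLocalTypeISingularPoint r₀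
z u p — the body of the registered
   open statement Literature.Analysis.FluidPDE.LocalTypeISingularityExists INLINED (Iff.rfl-equal,
Check.lean rc 0; route-repair
   2026-08-15, so that no closed unproved Literature Prop sits in the used-constants cone);
TypeIBridge concludes the same ∃.
DECIDING THEOREM (certified native, rev 7): closes : EnstrophyQuarterLaw → NoLocalTypeISingularity →
TypeIBridge → NoBlowupToClay →
NavierStokesRegularity (= the Assembly item, by name), PURE LOGIC, 5 lines: a non-extendable
solution is maximal,
(i) gives the enstrophy rate, TypeIBridge (support: sup over parabolic sub-balls of E(Q') =
r⁻¹∫∫|∇u|² ≤ 2K, then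
Albritton–Barker Lemma 2.6 = Seregin2006 Morrey estimates ⇒ 𝐈 < ∞ at a singular point, which exists
by far-field regularity +
LPS continuation) produces a local Type-I singular point, (ii) forbids it; hence NoBlowup (=
stmt-NavierStokesRegularity-0054,
re-asked as Target) and NoBlowupToClay (= stmt-0055, the shared local theory, item #5) gives Clay
(A). No unproved named fact
sits in the cone (gate deps: 0 unproved of 57): AB's reverse direction is proved in tree and the
forward direction is not used
because (ii) is the LOCAL statement.

Rationale: WHY THIS LINE. The card's primary thesis X_Λ (∫₀ᵀ Λ dt < ∞ a priori) is, per solution, a restatement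
of NoBlowup (Λ ≤ ‖∇u‖_∞ is
bounded on every closed regular slab) and, uniformly in the H¹ size of the datum, Tao-equivalent to
(A) (Tao2011 localisation):
filing it as the crux would repeat route VorticityGeometry's "∃ after ∀u" defect. What the spectral
bookkeeping DOES single out is a
sharp-constant dichotomy: blow-up needs the binding history to beat ¼log(1/(T−t)) (Leray1934 §19
lower bound), and the matching
upper bound is exactly "enstrophy at Leray's rate", i.e. Type I in the RESCALED-ENERGY sense
E(Q(z,r)) = r⁻¹∫∫|∇u|² ≤ 2K uniformly
in z and r — the one Type-I notion for which Albritton–Barker's characterisation (arXiv:1811.00502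
Thm 1.1, Lemma 2.6) needs no
extra hypothesis (their Rem 3.2: the popular L^∞ rate alone does not give 𝐈 < ∞). So the route
decomposes NoBlowup as
[no enstrophy-Type-II] + [no Type-I singular point], an alternative to TypeILiouville's [NoTypeII in
L^∞, stmt-0056] + [(L), 0057]:
crux (i) is neither weaker nor stronger than 0056 but feeds the Liouville half with no gap, is
UNIFORM over singular points (all of
ℝ³×{T} at once; under (i) the singular set at T is finite, ≤ K'/ν^{5/2} points — leray-quanta graft,
not filed), and carries the
card's spectral reformulation with the sharp constant ¼. Imported areas: Schrödinger spectral theory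
(Rayleigh quotients, Hardy's ¼,
Fefferman–Phong balls) for the organising functional; parabolic blow-up rescaling + Liouville
rigidity (KNSS2009, SereginSverak2009,
AlbrittonBarker2019) for the assembly. Relation to GaldiLiouvilleGate (opened today): both clock
blow-up by ENSTROPHY; that route
zooms at enstrophy records into the finite-Dirichlet ancient class, this one asserts the Leray rate
and lands in AB's Type-I class.
RANKED CRUXES. #2 EnstrophyQuarterLaw (hardest, most informative: its negation is an
enstrophy-Type-II singularity = ¬A; with
SereginSverak2009-type exclusions it would settle axisymmetric scenarios). #3
NoLocalTypeISingularity (open; refuted by any Type-I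
e.g. λ-DSS singular suitable weak solution — cf. Blowup crux stmt-0155, DssFarFieldSlaving; implied
by (L) via AB-forward).
SUPPORT (provable with known tools, ranked for reading order only): #4 TypeIBridge (AB Lemma 2.6 /
Seregin2006; CKN far field;
LPS continuation; ν-rescaling), #5 NoBlowupToClay (= stmt-0055), #6 BindingCriterion (the Λ-lemma:
any admissible rate function Λ
with ∫₀ᵀΛ < ∞ ⇒ extension; enstrophy identity + Kato +
TaoBoundedEnstrophyContinuation/LerayH1Continuation in tree; corollaries
Hardy face / Sobolev face to be attached with --supports), #7 DssProfileBinding (card F3: a λ-DSS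
classical blow-up profile must
BIND — Λ(t) > 0 at some phase — and be super-Hardy about EVERY centre: sup_x |x−x₀|²α₊ > ν/4;
ansatz-free necessary condition for
CertifiedBlowup/Blowup witnesses), #8 SuperHardySingularity (sibling A0: Hardy-subcritical
stretching |x−x₀|²α ≤ (¼−δ)ν in a
backward cylinder ⇒ (x₀,T) regular; sharp-constant ε-regularity via Hardy + Kato + CKN-generic
regular shell + local Serrin).
TARGET NoBlowup (= stmt-0054). ASSEMBLY pure logic.
KILL CRITERIA. A finite-energy blow-up with limsup (T−t)^{1/2}Ω(t) = ∞ refutes #2 and is ¬A (close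
refuted:EnstrophyQuarterLaw, hand
to Blowup). LocalTypeISingularityExists proved (e.g. a Type-I DSS singular suitable weak solution)
refutes #3: pivot available only
if the witness has infinite energy AND #2 can be strengthened to exclude its profile
(DssProfileBinding is the relevant test);
otherwise close. NoBlowup proved elsewhere moots the route. Cheap internal falsifier of the
MECHANISM (not of A): a regular flow on
which Λ(t) ≫ Λ_eff(t) persistently (Λ over-counts when |ω| is far from the ground state) — would
demote Λ to bookkeeping; the
assembly does not depend on it.
NOT DECOMPOSED (deliberately). How #2 would be proved (card B3 'binding episodes' self-consistency
via Biot–Savart/Constantin1990 —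
no precise statement survives dimensional counting yet; Fefferman–Phong face B2 and the
Alvino–Lions–Trombetti symmetrisation B4 are
foreseen lemmas under BindingCriterion, not items); the class bookkeeping inside TypeIBridge; (L) ⇒
#3 (needs AB-forward =
Seregin–Šverák rescaling, named fact Literature.Analysis.FluidPDE.AlbrittonBarkerForward — kept OUT
of the cone on purpose).
TWO-LAYER PLAN (D-0019). Layer 1 = the two cruxes. Layer 2 (glued splits, only after a crux moves):
#2 ⇐ [quarter law on
enstrophy-record windows] ∧ [no acceleration between records]; #3 ⇐ AB-forward ∧ (L'), or ⇐
DSS/few-well Liouville cases.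
NUMBERS. Items at open: 9 (2 cruxes, 5 support, target, assembly). Sharp constants in play: Hardy ¼
(ℝ³), Leray exponent ½,
Sobolev threshold ‖α₊‖_{3/2} > 3(π/2)^{4/3}ν for binding. Known: Leray lower bound (in tree
leray_blowup_rate_top, conditional on
leray_strong_local_existence); AB Thm 1.1 reverse direction PROVED in tree, forward = named fact;
(L) open (KNSS2009), Type-I DSS
Liouville open (TypeIDSSLiouvilleConjecture); no upper bound on any blow-up rate is known
(Tao2021QuantitativeNS: triple-log only).

Novelty: NOVELTY (searched 2026-08-15; local lit index DOWN (searchd connection reset), OpenAlex/S2/arXiv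
HTTP 429, galaxy unavailable twice —
recorded; crossref worked: "Navier-Stokes regularity criterion vorticity direction stretching" (15
rows: Zhou 2004/05, Beirão da
Veiga–Berselli 2009, Berselli 2023 doi:10.1088/1361-6544/ace096, Vasseur 2009 — all direction/size
criteria, none spectral),
"Chae spectral dynamics deformation tensor" (Chae2005 doi:10.1007/s00220-005-1465-8: α = ξ·Sξ
criteria, Euler/NS), "blow-up rate
enstrophy Type I" (Chen–Strain–Yau–Tsai 2008 lower bounds; nothing asserting or using an enstrophy
UPPER rate), "Seregin critical
Morrey" (Seregin2006/Seregin2007Morrey doi:10.1007/s10958-007-0178-2); READ arXiv:1811.00502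
pp.3,6,7 (Type-I notion 𝐈, Lemma 2.5
weak Serrin ⇒ Type I, Lemma 2.6 Morrey estimates: sup_{Q'}E < ∞ ⇒ 𝐈 < ∞, Rem 3.2 L^∞ rate
insufficient); in-tree LocalTypeI.lean,
SelfSimilarLiouville.lean, NSLerayHopf.lean (leray_blowup_rate_top), all 8 NS route files; the
card's refuter audit (refuter-5/6).
Nearest prior art: (a) the Type-I/Liouville programme KNSS2009 (arXiv:0709.3599), SereginSverak2009
(arXiv:0804.1803),
AlbrittonBarker2019 (arXiv:1811.00502) and its in-tree rendering — crux #3 IS AB's first bullet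
negated and crux #2 is a Type-I
hypothesis; in-house route TypeILiouville (stmt-0056/0057) is the L^∞-rate sibling; (b)
stretching-rate / strain criteria
BealeKatoMajda1984, ConstantinFefferman1993, Constantin1990 (doi:10.1007/bf02096982, a-priori  [refs: 10.1088/1361-6544/ace096, 10.1007/s00220-005-1465-8:, 10.1007/s10958-007-0178-2, 10.1007/bf02096982, 10.1017/s0013091503000506, 10.1006/jfan.1999.3556, 10.1090/s0273-0979-1983-15154-6, 1811.00502, 0709.3599, 0804.1803, 1710.05569, doi:10.1088/1361-6544/ace096, doi:10.1007/s00220-005-1465-8, doi:10.1007/s10958-007-0178-2, doi:10.1007/bf02096982, doi:10.1017/s0013091503000506, doi:10.1006/jfan.1999.]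

Barriers (technique_class: spectral-threshold type-I-blowup-rate energy-methods): BARRIERS (catalogue lean/Literature/Barriers/NavierStokesRegularity read: 18 entries;
technique_class: spectral-threshold type-I-blowup-rate energy-methods).
- Literature.Barriers.NavierStokesRegularity.EnergySupercriticality: APPLIES to crux #2. Enstrophy
is supercritical (energyExponent
  −1), and the Λ-lemma dΩ/dt ≤ 2ΛΩ is an energy-class inequality; an upper RATE bound (T−t)^{1/2}Ω ≤
K is a critical statement to be
  won from supercritical data — NOT evaded by BindingCriterion or its faces. The bet named honestly:
#2 can only come from structure
  the barrier's class lacks (one-signed stretching α = ξ·Sξ generated by Biot–Savart from misaligned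
vorticity; Constantin1990's
  a-priori ∫∫|ω||∇ξ|²; self-consistency of a well dug by its own bound state), none of which is a
filed item yet. Crux #3 and the
  assembly are scale-invariant (𝐈, Liouville) and never use energy coercively (energy enters
TypeIBridge only to bound unit-scale A, D).
- Literature.Barriers.NavierStokesRegularity.TaoAveragedBlowup: Tao's averaged blow-up is Type II
with exploding critical norms, so
  for an averaged bilinear form crux #2 is FALSE: any proof of #2 must distinguish B from B̃.
Available distinction (form only, no
  claim of evasion): the vorticity transport structure — Kato on |ω|, α one-signed and ≤ λ_max(S),
divergence-free drift invisible
  to symmetrisation — does not exist for B̃ (no vorticity equation). Crux #3's known cases (KNSS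
Thms 5.1–5.3) run on maximum
  principles for ω_θ/r, r u_

History (route lifecycle, newest last):
- 2026-08-15T16:17:01Z · rev 5: restated NoLocalTypeISingularity (stmt-NavierStokesRegularity-1575) — route-repair (staffability): restate crux NoLocalTypeISingularity 1:1 with the body of Literature.Analysis.FluidPDE.LocalTypeISingularityExists inlined (Iff.rfl (planner-rbadge-NavierStokesRegularity-Stretchi-dde86843-g2-0)
- 2026-08-15T16:17:51Z · rev 6: restated TypeIBridge (stmt-NavierStokesRegularity-1576) — route-repair (staffability): restate support TypeIBridge 1:1 with its conclusion LocalTypeISingularityExists inlined (Iff.rfl-equal, planner Check.lean rc 0); m (planner-rbadge-NavierStokesRegularity-Stretchi-dde86843-g2-0)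
- 2026-08-15T16:21:00Z · rev 8: restated Assembly (stmt-NavierStokesRegularity-1573) — route-repair: restate Assembly BY NAME over the route's items (EnstrophyQuarterLaw → NoLocalTypeISingularity → TypeIBridge → NoBlowupToClay → NavierStokesRegula (planner-rbadge-NavierStokesRegularity-Stretchi-dde86843-g2-0)
- 2026-08-22T20:51:20Z · DORMANT — reconciler: no traction for 5.6 d (last activity item-evidence-added at 2026-08-17T04:37:01Z); parked, not closed — `ledger route dormant route-NavierStokesRegu (operator:999:3714376)
- 2026-08-26T13:40:33Z · REACTIVATED — reconciler: reactivated — activity item-proof-filed at 2026-08-26T12:45:27Z after parking at 2026-08-22T20:51:20Z (operator:999:3256039)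
- 2026-08-29T19:39:03Z · DORMANT — census g0: costume|duplicate of route-NavierStokesRegularity-HalfHolderEnergy; reader census-reader-50-g0 (operator:999:1526080)

sub-problem: NavierStokesRegularity · status: dormant · opened planner-plancard-NavierStokesRegularity-Navie-e044e5f3-0 2026-08-15T10:57:26Z · rev 9 · ledger route-NavierStokesRegularity-StretchingWellBinding
GENERATED by the gate from the ledger (D-0016/17). Provers cite these decls: `theorem foo : Summit.NavierStokesRegularity.NavierStokesRegularity.Theses.StretchingWellBinding.<Decl> := …` in Summits/NavierStokesRegularity/NavierStokesRegularity/Theorems/<Name>.lean.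
-/

namespace Summit.NavierStokesRegularity.NavierStokesRegularity.Theses.StretchingWellBinding

open scoped BigOperators Topology Manifold Classical MeasureTheory ProbabilityTheory Matrix InnerProductSpace ComplexConjugate ContinuousMap
open Filter Set Function TopologicalSpace MeasureTheory

attribute [summit_statement] _root_.NavierStokesRegularity

open Literature.NS

/-- item stmt-NavierStokesRegularity-0054 · target · rank 0 · open · by planner
why it might fail: It is Clay (A) for the physical solution: false iff one rapidly decaying divergence-free datum blows up in finite time (Hou2022 axisymmetric numerics is the standing candidate); energy/harmonic-analysis methods alone cannot prove it (Tao2016 averaged blow-up, EnergySupercriticality).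
sources: Fefferman2000, Tao2016AveragedNS, Hou2022PotentiallySingularNS, Leray1934, Literature.Barriers.NavierStokesRegularity.EnergySupercriticality, Literature.Barriers.NavierStokesRegularity.TaoAveragedBlowup
For every ν>0 and every classical solution (u,p) of unforced NS on ℝ³×[0,T) which is Leray–Hopf
(finite energy) from a rapidly decaying datum u(0), the solution extends as a classical solution
past T. Equivalent packaging of 'no finite-time singularity for the physical solution'. -/
@[route_item "route-NavierStokesRegularity-StretchingWellBinding"]
def NoBlowup : Prop :=
  ∀ (ν T : ℝ), 0 < ν → 0 < T → ∀ (u : ℝ → EuclideanSpace ℝ (Fin 3) → EuclideanSpace ℝ (Fin 3)) (p : ℝ → EuclideanSpace ℝ (Fin 3) → ℝ), Literature.Analysis.FluidPDE.IsClassicalNSSolutionOn (Set.Ico 0 T) ν 0 u p → Literature.Analysis.FluidPDE.IsLerayHopfOn T ν 0 (u 0) u → Literature.Analysis.FluidPDE.HasRapidSpatialDecay (u 0) → Literature.Analysis.FluidPDE.HasSmoothExtensionPast ν 0 u T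

/-- item stmt-NavierStokesRegularity-1574 · crux · rank 2 · open · by planner
why it might fail: Says every finite-energy blow-up is Type I in scaled energy (Leray's rate); no upper bound on any NS blow-up rate is known (Tao2021: triple log). With Seregin2020 Thm 2.1 (axisymmetric singular points are Type II) it gives axisymmetric regularity: one singular axisymmetric flow (Hou2022) kills it.
sources: Leray1934, Seregin2020, arXiv:2006.04140, Hou2022PotentiallySingularNS, arXiv:2107.06509, Tao2021QuantitativeNS
[crux] QUARTER LAW / enstrophy at Leray's rate (card F6; absorbs leray-quanta-energy-modulus X_H).
If a finite-energy classical solution from a rapidly decaying datum is maximal at T<oo, then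
Omega(t) = int |curl u(t)|^2 <= K (T-t)^{-1/2} on [0,T) for some K (lintegral form: infinite
enstrophy violates it). Leray1934 sec.19-22 gives the matching LOWER bound Omega >= c
nu^{3/2}(T-t)^{-1/2} (in tree: leray_blowup_rate_top family), so the claim is 'dissipation blows up
at exactly Leray's rate'. Spectral form (the card's thesis object): with alpha = xi.(grad u)xi and
Lambda(t) = sup_psi (int alpha_+|psi|^2 - nu int|grad psi|^2)/int|psi|^2 = sup spec(nu Lap +
alpha_+), one has d/dt log Omega <= 2 Lambda, blow-up forces int_{t0}^t Lambda >= (1/4) log(1/(T-t))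
- C, and the crux is equivalent to int_{t0}^t (Lambda_eff - 1/(4(T-s))) ds = O(1) with Lambda_eff :=
(1/2) d/dt log Omega <= Lambda: 'Type II <=> the stretching well binds more than a quarter per unit
log-time'. Consequences (not filed): E(Q(z,r)) = r^{-1} intint_Q |grad u|^2 <= 2K/nu-scaled for
EVERY parabolic ball below T (uniform rescaled-energy Type I => TypeIBridge); expected, to be
checked (leray-quanta graft): finitely many s -/
@[route_item "route-NavierStokesRegularity-StretchingWellBinding", crux]
def EnstrophyQuarterLaw : Prop :=
  ∀ (ν T : ℝ), 0 < ν → 0 < T → ∀ (u : ℝ → EuclideanSpace ℝ (Fin 3) → EuclideanSpace ℝ (Fin 3)) (p : ℝ → EuclideanSpace ℝ (Fin 3) → ℝ), Literature.Analysis.FluidPDE.IsMaximalSmoothSolution ν 0 u p T → Literature.Analysis.FluidPDE.IsLerayHopfOn T ν 0 (u 0) u → Literature.Analysis.FluidPDE.HasRapidSpatialDecay (u 0) → ∃ K : ℝ, ∀ t ∈ Set.Ico 0 T, ∫⁻ x, ‖Literature.Analysis.FluidPDE.curl (u t) x‖ₑ ^ 2 ≤ ENNReal.ofReal (K / Real.sqrt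 (T - t))

-- earlier NoLocalTypeISingularity (stmt-NavierStokesRegularity-1575, replaced 2026-08-15T16:17:01Z -> stmt-NavierStokesRegularity-10480): retired by None — ¬ Literature.Analysis.FluidPDE.LocalTypeISingularityExists
/-- item stmt-NavierStokesRegularity-10480 · crux · rank 3 · open · by planner
why it might fail: Negates the registered OPEN statement (AB2019 Thm 1.1 first bullet; §1: Type-I scenarios 'completely open'). No energy hypothesis: any local Type-I singular suitable weak solution, e.g. a singular backward lambda-DSS profile (excluded only for lambda~1 ChaeWolf2017, exact SS NRS1996), kills it.
sources: AlbrittonBarker2019, arXiv:1811.00502, KNSS2009, arXiv:0709.3599, SereginSverak2009, Seregin2020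
[crux] No Type-I singular point: the first bullet of Albritton-Barker 2019 Thm 1.1 NEGATED - no
suitable weak solution (nu=1) in a parabolic ball Q(z,r0) has its centre as a backward singular
point with AB's Type-I quantity I(Q(z,r0)) = sup over parabolic sub-balls of A+C+D+E finite.
RESTATED 2026-08-15 (route-repair, staffability): the body of the registered open statement
Literature.Analysis.FluidPDE.LocalTypeISingularityExists (LocalTypeI.lean, [status: open]) is
INLINED over the printed notion IsLocalTypeISingularPoint, so that no closed unproved Literature
Prop sits in the route's used-constants cone; the item is Iff.rfl-equal to `¬
LocalTypeISingularityExists` (planner Check.lean rc 0), so every in-tree lemma about that name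
applies verbatim (e.g. refutation via
localTypeISingularityExists_of_nontrivialMildAncientTypeIExists). Status: OPEN; expected TRUE under
the KNSS Liouville conjecture (L) (stmt-0057, route TypeILiouville) via AB's forward direction
(named fact AlbrittonBarkerForward = Seregin-Sverak rescaling) and equivalent, under that fact, to
(L') = not NontrivialMildAncientTypeIExists (AB reverse direction PROVED in tree). Known cases:
axisymmetric (SereginSverak2009 -/
@[route_item "route-NavierStokesRegularity-StretchingWellBinding", crux]
def NoLocalTypeISingularity : Prop :=
  ¬ ∃ (r₀ : ℝ) (z : ℝ × EuclideanSpace ℝ (Fin 3)) (u : ℝ → EuclideanSpace ℝ (Fin 3) → EuclideanSpace ℝ (Fin 3)) (p : ℝ → EuclideanSpace ℝ (Fin 3) → ℝ), Literature.Analysis.FluidPDE.IsLocalTypeISingularPoint r₀ z u p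

-- earlier TypeIBridge (stmt-NavierStokesRegularity-1576, replaced 2026-08-15T16:17:51Z -> stmt-NavierStokesRegularity-10521): retired by None — ∀ (ν T : ℝ), 0 < ν → 0 < T → ∀ (u : ℝ → EuclideanSpace ℝ (Fin 3) → EuclideanSpace ℝ (Fin 3)) (p : ℝ → EuclideanSpace ℝ (Fin 3) → ℝ), Literature.Analysis.FluidPDE.IsMaximalSmoothSolution ν 0 u p T → Literature.Analysis.FluidPDE.IsLerayHopfOn T ν 0 (u 0) u → L
/-- item stmt-NavierStokesRegularity-10521 · support · rank 4 · closed · proved by Summit.NavierStokesRegularity.NavierStokesRegularity.Theorems.stretchingWellBinding_typeIBridge_proof (prover) · by planner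
sources: arXiv:1811.00502, Seregin2006, Seregin2007Morrey, CKN1982, Lin1998, Serrin1962
[support] Enstrophy Type I => a local Type-I singular point exists (conclusion = the body of
Literature.Analysis.FluidPDE.LocalTypeISingularityExists INLINED, 2026-08-15 route-repair for
staffability; Iff.rfl-equal to the earlier form, planner Check.lean rc 0). Given a maximal (no
smooth extension past T) finite-energy classical solution from a rapidly decaying datum with
Omega(t) <= K(T-t)^{-1/2}: (1) rescale to nu=1 (nsRescale; classes invariant); (2) a backward
singular point (T,x0) exists: otherwise u is essentially bounded near every point of {T} x
closure(B_R) (compactness) and for |x|>R by far-field regularity of Leray-Hopf solutions from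
decaying data (CKN1982 Thm C/D type; in tree LerayFarFieldRegularity*), so u in L^infty((T-eps,T) x
R^3) and LPS continuation (ladyzhenskaya_prodi_serrin / beale_kato_majda family) extends u past T -
contradiction; (3) (u, p~) with the normalised pressure p~ = R_iR_j(u_iu_j) (differs from p by c(t);
p~ in L^{5/3}_{t,x}) is a suitable weak solution in Q((T,x0),r0), r0^2<T (classical => local energy
equality; ClassicalSuitable.lean); (4) for every parabolic sub-ball Q(z',r') below T: E(Q') =
r'^{-1} intint |grad u|^2 <= r'^{-1} int_{T-r'^2}^{ -/
@[route_item "route-NavierStokesRegularity-StretchingWellBinding", crux]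
def TypeIBridge : Prop :=
  ∀ (ν T : ℝ), 0 < ν → 0 < T → ∀ (u : ℝ → EuclideanSpace ℝ (Fin 3) → EuclideanSpace ℝ (Fin 3)) (p : ℝ → EuclideanSpace ℝ (Fin 3) → ℝ), Literature.Analysis.FluidPDE.IsMaximalSmoothSolution ν 0 u p T → Literature.Analysis.FluidPDE.IsLerayHopfOn T ν 0 (u 0) u → Literature.Analysis.FluidPDE.HasRapidSpatialDecay (u 0) → (∃ K : ℝ, ∀ t ∈ Set.Ico 0 T, ∫⁻ x, ‖Literature.Analysis.FluidPDE.curl (u t) x‖ₑ ^ 2 ≤ ENNReal.ofReal (K / Real.sqrt (T - t))) → ∃ (r₀ : ℝ) (z : ℝ × EuclideanSpace ℝ (Fin 3)) (v : ℝ → EuclideanSpace ℝ (Fin 3) → EuclideanSpace ℝ (Fin 3)) (q : ℝ → EuclideanSpace ℝ (Fin 3) → ℝ), Literature.Analysis.FluidPDE.IsLocalTypeISingularPoint r₀ z v q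

-- `TypeIBridge` holds: proved by `Summit.NavierStokesRegularity.NavierStokesRegularity.Theorems.stretchingWellBinding_typeIBridge_proof` (its module imports this route file, so no `_holds` link can be stated here).

/-- item stmt-NavierStokesRegularity-0055 · support · rank 5 · closed · proved by Summit.NavierStokesRegularity.NavierStokesRegularity.Theorems.typeICertificateLadder_noBlowupToClay_proof @ 8d57e70af7e2 (prover) · by planner
sources: Leray1934, Fefferman2000, FujitaKato1964, Kato1984, CKN1982
Given NoBlowup, build the Clay (A) solution: local finite-energy classical solution for smooth
divergence-free rapidly decaying data (Leray 1934 §III / Fujita–Kato 1964 + LPS smoothing), continue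
past every T using NoBlowup, glue by weak–strong uniqueness (Prodi–Serrin), bounded energy from the
energy inequality, and convert with
Literature.Analysis.FluidPDE.isNavierStokesSolution_and_smooth_iff. Blow-up at spatial infinity is
excluded by CKN ε-regularity applied far out. May take named Literature facts (leray_existence_R3,
ladyzhenskaya_prodi_serrin, weak_strong_uniqueness, fujita_kato_local) as hypotheses if the grounder
so rules. -/
@[route_item "route-NavierStokesRegularity-StretchingWellBinding", crux]
def NoBlowupToClay : Prop :=
  (∀ (ν T : ℝ), 0 < ν → 0 < T → ∀ (u : ℝ → EuclideanSpace ℝ (Fin 3) → EuclideanSpace ℝ (Fin 3)) (p : ℝ → EuclideanSpace ℝ (Fin 3) → ℝ), Literature.Analysis.FluidPDE.IsClassicalNSSolutionOn (Set.Ico 0 T) ν 0 u p → Literature.Analysis.FluidPDE.IsLerayHopfOn T ν 0 (u 0) u → Literature.Analysis.FluidPDE.HasRapidSpatialDecay (u 0) → Literature.Analysis.FluidPDE.HasSmoothExtensionPast ν 0 u T) → NavierStokesRegularity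

/-- `NoBlowupToClay` holds: proved by `Summit.NavierStokesRegularity.NavierStokesRegularity.Theorems.typeICertificateLadder_noBlowupToClay_proof` @ 8d57e70af7e2. -/
theorem NoBlowupToClay_holds : NoBlowupToClay := _root_.Summit.NavierStokesRegularity.NavierStokesRegularity.Theorems.typeICertificateLadder_noBlowupToClay_proof

/-- item stmt-NavierStokesRegularity-1577 · support · rank 6 · closed · proved by Summit.NavierStokesRegularity.NavierStokesRegularity.Theorems.stretchingWellBinding_bindingCriterion_proof (prover) · by planner
sources: BealeKatoMajda1984, Constantin1990, BusnelloFlandoliRomito2005, Chae2005, MillerStrain2020, Fefferman1983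
[support] THE LAMBDA-LEMMA (card B1; the route's organising object made a theorem). For a
finite-energy classical solution on [0,T) from a rapidly decaying datum let alpha(t,x) := <xi, (grad
u(t,x)) xi>, xi := vorticityDirection(curl u(t)) x (= xi.S xi, the antisymmetric part drops out). If
Lambda : R -> R is an ADMISSIBLE RATE - for every t<T and every smooth compactly supported vector
test field psi, int alpha_+ |psi|^2 - nu int |grad psi|_F^2 <= Lambda(t) int |psi|^2 (i.e. Lambda(t)
>= sup spec(nu Lap + alpha_+(t)); the vector and scalar Rayleigh suprema agree by Kato/diamagnetism)
- and Lambda is integrable on [0,T), then u extends classically past T. Proof: enstrophy identity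
d/dt (1/2)||omega||^2 = int <omega,(grad u)omega> - nu||grad omega||^2 (in tree:
TaoEnstrophyIdentity / EnstrophyGronwall machinery; slices are H^infty by tao2011 closed-slab
bounds), <omega,(grad u)omega> = |omega|^2 alpha <= alpha_+|omega|^2, apply the hypothesis to psi =
omega(t) chi_R and let R -> oo (H^1 cut-off), Gronwall: Omega(t) <= Omega(0) exp(2 int_0^t Lambda^+)
bounded on [0,T); bounded enstrophy => extension (TaoBoundedEnstrophyContinuation /
leray_continuation_H1 / HasSobolevExtensionPast.ha -/
@[route_item "route-NavierStokesRegularity-StretchingWellBinding"]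
def BindingCriterion : Prop :=
  ∀ (ν T : ℝ), 0 < ν → 0 < T → ∀ (u : ℝ → EuclideanSpace ℝ (Fin 3) → EuclideanSpace ℝ (Fin 3)) (p : ℝ → EuclideanSpace ℝ (Fin 3) → ℝ), Literature.Analysis.FluidPDE.IsClassicalNSSolutionOn (Set.Ico 0 T) ν 0 u p → Literature.Analysis.FluidPDE.IsLerayHopfOn T ν 0 (u 0) u → Literature.Analysis.FluidPDE.HasRapidSpatialDecay (u 0) → ∀ Λ : ℝ → ℝ, (∀ t ∈ Set.Ico 0 T, ∀ ψ : EuclideanSpace ℝ (Fin 3) → EuclideanSpace ℝ (Fin 3), ContDiff ℝ (⊤ : ℕ∞) ψ → HasCompactSupport ψ → (∫ x, max 0 (inner ℝ (Literature.Analysis.FluidPDE.vorticityDirection (Literature.Analysis.FluidPDE.curl (u t)) x) ((fderiv ℝ (u t) x) (Literature.Analysis.FluidPDE.vorticityDirection (Literature.Analysis.FluidPDE.curl (u t)) x))) * ‖ψ x‖ ^ 2) - ν * (∫ x, Literature.Analysis.FluidPDE.frobeniusNormSq (fderiv ℝ ψ x)) ≤ Λ t * ∫ x, ‖ψ x‖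 ^ 2) → MeasureTheory.IntegrableOn Λ (Set.Ico 0 T) → Literature.Analysis.FluidPDE.HasSmoothExtensionPast ν 0 u T

-- `BindingCriterion` holds: proved by `Summit.NavierStokesRegularity.NavierStokesRegularity.Theorems.stretchingWellBinding_bindingCriterion_proof` (its module imports this route file, so no `_holds` link can be stated here).

/-- item stmt-NavierStokesRegularity-1578 · support · rank 7 · closed · proved by Summit.NavierStokesRegularity.NavierStokesRegularity.Theorems.stretchingWellBinding_dssProfileBinding_proof (prover) · by planner
sources: ChaeWolf2017RemovingDSS, arXiv:1610.09464, BradshawTsai2017CPDE, NecasRuzickaSverak1996, Tsai1998, VazquezZuazua2000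
[support] CARD F3 - THE DELIVERABLE (refuter-novelty-audit-5): ansatz-free necessary conditions on
discretely self-similar blow-up. Let (u,p) be a classical NS solution (nu=1) on R^3 x (-oo,0),
lambda-DSS (lambda>1), with scale-invariant bounds of all orders (|x|+sqrt(-t))^{k+1}|D^k u(t,x)| <=
C_k (the Type-I class of ChaeWolf2017RemovingDSS Thm 1.1 once smoothness off the origin is known),
not identically zero at some negative time. Then at some t<0 the stretching well BINDS: some smooth
compactly supported psi has int alpha_+(t)|psi|^2 - int|grad psi|_F^2 > 0 (Lambda(t) > 0), and the
stretching is SUPER-HARDY ABOUT EVERY CENTRE: for all x0 there is x with |x-x0|^2 alpha_+(t,x) >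
1/4. Proof: Omega(t0) in (0,oo) (enstrophy finite by the k=1 bound; positive since a harmonic
decaying slice is 0); DSS gives Omega(lambda^{-2k} t0) = lambda^k Omega(t0) -> oo; the Lambda-lemma
on [t0, lambda^{-2k}t0] (enstrophy identity valid: all terms O((|x|+1)^{-6})) forces int Lambda =
oo, hence Lambda(t)>0 somewhere (indeed on a positive-measure set of phases); Hardy's inequality
with sharp constant 4 turns 'sup_x |x-x0|^2 alpha_+ <= 1/4' into Lambda(t) <= 0. In similarity
variables (alpha = lambda( -/
@[route_item "route-NavierStokesRegularity-StretchingWellBinding"]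
def DssProfileBinding : Prop :=
  ∀ (c : ℝ), 1 < c → ∀ (u : ℝ → EuclideanSpace ℝ (Fin 3) → EuclideanSpace ℝ (Fin 3)) (p : ℝ → EuclideanSpace ℝ (Fin 3) → ℝ), Literature.Analysis.FluidPDE.IsClassicalNSSolutionOn (Set.Iio 0) 1 0 u p → Literature.Analysis.FluidPDE.IsDiscretelySelfSimilar c u → (∀ k : ℕ, ∃ C : ℝ, ∀ t < 0, ∀ x, (‖x‖ + Real.sqrt (-t)) ^ (k + 1) * ‖iteratedFDeriv ℝ k (u t) x‖ ≤ C) → (∃ t < 0, u t ≠ 0) → ∃ t < 0, (∃ ψ : EuclideanSpace ℝ (Fin 3) → EuclideanSpace ℝ (Fin 3), ContDiff ℝ (⊤ : ℕ∞) ψ ∧ HasCompactSupport ψ ∧ 0 < (∫ x, max 0 (inner ℝ (Literature.Analysis.FluidPDE.vorticityDirection (Literature.Analysis.FluidPDE.curl (u t)) x) ((fderiv ℝ (u t) x) (Literature.Analysis.FluidPDE.vorticityDirection (Literature.Analysis.FluidPDE.curl (u t)) x))) * ‖ψ x‖ ^ 2) - (∫ x, Literature.Analysis.FluidPDE.frobeniusNormSq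 (fderiv ℝ ψ x))) ∧ ∀ x₀ : EuclideanSpace ℝ (Fin 3), ∃ x, 1 / 4 < ‖x - x₀‖ ^ 2 * max 0 (inner ℝ (Literature.Analysis.FluidPDE.vorticityDirection (Literature.Analysis.FluidPDE.curl (u t)) x) ((fderiv ℝ (u t) x) (Literature.Analysis.FluidPDE.vorticityDirection (Literature.Analysis.FluidPDE.curl (u t)) x)))

-- `DssProfileBinding` holds: proved by `Summit.NavierStokesRegularity.NavierStokesRegularity.Theorems.stretchingWellBinding_dssProfileBinding_proof` (its module imports this route file, so no `_holds` link can be stated here).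

/-- item stmt-NavierStokesRegularity-1579 · support · rank 8 · open · by planner
sources: CKN1982, CaffarelliKohnNirenberg1982, Serrin1962, VazquezZuazua2000, Constantin1990, BealeKatoMajda1984
[support] 'EVERY SINGULARITY IS SUPER-HARDY' (sibling card hardy-quarter-stretching-spectrum, item
A0; explicit epsilon = 1/4). For a finite-energy classical solution on [0,T) from a rapidly decaying
datum, a centre x0, radius rho (rho^2<T) and delta>0: if the stretching rate is Hardy-subcritical in
the backward cylinder, |x-x0|^2 alpha(t,x) <= (1/4-delta) nu for x in B_rho(x0), T-rho^2<t<T, then u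
is essentially bounded on some (T-r^2,T) x B_r(x0), i.e. (T,x0) is not a (backward) singular point.
Contrapositive: at a first-time singularity limsup |x-x0|^2 (xi.S xi)_+ >= nu/4 - the stretching of
any blow-up must beat Hardy's constant. Sketch (checked by refuter-6 on the sibling card): CKN
P^1(S)=0 at time T => a.e. sphere radius rho' < rho misses the singular set, regular points are open
=> a shell around dB_rho' is regular on (T-eps,T]; localise the enstrophy identity with a cut-off
phi = 1 on B_rho'' , transport and cut-off terms live on the regular shell; Kato + Hardy (constant 4
in R^3) + the hypothesis give d/dt (1/2) int |omega|^2 phi^2 <= -4 delta nu int |grad(|omega|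
phi)|^2 + C_shell, so local enstrophy stays bounded up to T; local Biot-Savart => u in L^infty_t
L^6_x near x -/
@[route_item "route-NavierStokesRegularity-StretchingWellBinding"]
def SuperHardySingularity : Prop :=
  ∀ (ν T : ℝ), 0 < ν → 0 < T → ∀ (u : ℝ → EuclideanSpace ℝ (Fin 3) → EuclideanSpace ℝ (Fin 3)) (p : ℝ → EuclideanSpace ℝ (Fin 3) → ℝ), Literature.Analysis.FluidPDE.IsClassicalNSSolutionOn (Set.Ico 0 T) ν 0 u p → Literature.Analysis.FluidPDE.IsLerayHopfOn T ν 0 (u 0) u → Literature.Analysis.FluidPDE.HasRapidSpatialDecay (u 0) → ∀ (x₀ : EuclideanSpace ℝ (Fin 3)) (ρ δ : ℝ), 0 < ρ → 0 < δ → ρ ^ 2 < T → (∀ t ∈ Set.Ioo (T - ρ ^ 2) T, ∀ x ∈ Metric.ball x₀ ρ, ‖x - x₀‖ ^ 2 * (inner ℝ (Literature.Analysis.FluidPDE.vorticityDirection (Literature.Analysis.FluidPDE.curl (u t)) x) ((fderiv ℝ (u t) x) (Literature.Analysis.FluidPDE.vorticityDirection (Literature.Analysis.FluidPDE.curl (u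 t)) x))) ≤ (1 / 4 - δ) * ν) → ∃ r > 0, MeasureTheory.eLpNorm (Function.uncurry u) ⊤ (MeasureTheory.volume.restrict (Literature.Analysis.FluidPDE.parabolicCylinder r (T, x₀))) < ⊤

-- earlier Assembly (stmt-NavierStokesRegularity-1573, replaced 2026-08-15T16:21:00Z -> stmt-NavierStokesRegularity-10678): retired by None — (∀ (ν T : ℝ), 0 < ν → 0 < T → ∀ (u : ℝ → EuclideanSpace ℝ (Fin 3) → EuclideanSpace ℝ (Fin 3)) (p : ℝ → EuclideanSpace ℝ (Fin 3) → ℝ), Literature.Analysis.FluidPDE.IsMaximalSmoothSolution ν 0 u p T → Literature.Analysis.FluidPDE.IsLerayHopfOn T ν 0 (u 0) u → Lit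
/-- item stmt-NavierStokesRegularity-10678 · assembly · rank 1 · closed · proved by Summit.NavierStokesRegularity.NavierStokesRegularity.Theorems.stretchingWellBinding_assembly_proof (prover) · by planner
sources: Fefferman2000, arXiv:1811.00502
[assembly] EnstrophyQuarterLaw -> NoLocalTypeISingularity -> TypeIBridge -> NoBlowupToClay ->
NavierStokesRegularity, BY NAME over the route's own items (restated 2026-08-15, route-repair: the
earlier rendering inlined the item bodies and a fourth hypothesis = stmt-0055 that was not an item
of this route; now NoBlowupToClay is item #5 and this Prop is literally the type of the deciding
theorem `closes`, PROVED in the route file: fix nu,T,u,p as in NoBlowup; if u had no smooth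
extension past T it is maximal (IsMaximalSmoothSolution = classical on Ico 0 T and not
HasSmoothExtensionPast), the quarter law gives K, TypeIBridge yields a local Type-I singular point,
contradicting NoLocalTypeISingularity; hence NoBlowup, and NoBlowupToClay gives Clay (A)). A prover
closes this item with the same 5 lines (candidate proofs EV_SWB_Assembly.lean / W1.lean /
R1_Assembly.lean attached to stmt-1573 adapt by name). -/
@[route_item "route-NavierStokesRegularity-StretchingWellBinding"]
def Assembly : Prop :=
  EnstrophyQuarterLaw → NoLocalTypeISingularity → TypeIBridge → NoBlowupToClay → NavierStokesRegularity

-- `Assembly` holds: proved by `Summit.NavierStokesRegularity.NavierStokesRegularity.Theorems.stretchingWellBinding_assembly_proof` (its module imports this route file, so no `_holds` link can be stated here).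

/-! D-0027 §2.1 — DECIDING THEOREM (planner-authored via `route open/edit --closes-file`; by planner-rbadge-NavierStokesRegularity-Stretchi-dde86843-g2-0 2026-08-15T16:19:56Z):
its hypotheses are this route's items and its conclusion the sub-problem Statement (glue_lint), and it elaborates with this file. -/

@[closes "route-NavierStokesRegularity-StretchingWellBinding"] theorem closes (hQ : EnstrophyQuarterLaw) (hL : NoLocalTypeISingularity) (hB : TypeIBridge)
    (hClay : NoBlowupToClay) : NavierStokesRegularity := by
  apply hClay
  intro ν T hν hT u p hcl hLH hdec
  by_contra hext
  exact hL (hB ν T hν hT u p ⟨hcl, hext⟩ hLH hdec (hQ ν T hν hT u p ⟨hcl, hext⟩ hLH hdec))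

end Summit.NavierStokesRegularity.NavierStokesRegularity.Theses.StretchingWellBinding
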